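import Literature.MathematicalPhysics.QuantumLattice.HubbardHubbardModel
import Literature.MathematicalPhysics.QuantumLattice.HubbardGaugeBound
import Literature.MathematicalPhysics.QuantumLattice.TraceInequalitiesProofs
import Literature.MathematicalPhysics.QuantumLattice.LatticeToriProofs
import HarnessLib

/-!
# Proof of the Koma–Tasaki bounds (`koma_tasaki_magnetic`, `koma_tasaki_1d`)

Family `hubbard` (trunk T-QLATTICE), statement hubbard.S11. Sibling proof file of
`Literature/MathematicalPhysics/QuantumLattice/HubbardHubbardModel.lean`: it DISCHARGES the named
fact `Literature.MathematicalPhysics.QuantumLattice.koma_tasaki_magnetic` (`def … : Prop`, D-0014) of that file —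
`theorem koma_tasaki_magnetic_holds : koma_tasaki_magnetic` — from Mathlib and the accepted
prelude, following the printed proof of Koma–Tasaki (the McBryan–Spencer complex-rotation
method), and by the same argument with the charge gauge (eq. (5)) the one-dimensional
superconducting fact `koma_tasaki_1d` (`koma_tasaki_1d_holds`; the two-dimensional one,
`koma_tasaki_2d_holds`, is discharged in the sibling `HubbardHubbardModelPairDecayProofs.lean`
from the same trace bound, so it is not repeated here, although `norm_thermalCorr_onSitePair_le`
below gives it in one line as well). No statement is introduced or changed here. (With
`koma_tasaki_noLRO_of` of `HubbardHubbardModelProofs.lean`, `koma_tasaki_noLRO` follows from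
`koma_tasaki_2d_holds` and `koma_tasaki_magnetic_holds`; that one-line discharge belongs to that
file and is not made here.)

The magnetic statement: for the grand-canonical Hubbard model `hubbardTorusWith d L t U μ` on the tori
`(ℤ/Lℤ)^d` (any hopping `t`, interaction `U`, chemical potential `μ`) and every `β > 0`, the
thermal transverse spin correlation `⟨S⁺_x S⁻_y⟩_{β, L}` (`Matrix.thermalCorr`, `siteSpinPlus`)
obeys, uniformly in `L ≥ 1`, a power law `C (dist (x, y) + 1)^{-f}`, `f > 0`, for `d = 2`, and
an exponential bound `C e^{-m dist (x, y)}`, `m > 0`, for `d = 1`. The proof gives the explicit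
(far from optimal) values `f = 1 / (128 β |t| + 1)`, `C = e` (`d = 2`) and
`m = 1 / (16 β |t| + 1)`, `C = 1` (`d = 1`), independent of `U` and `μ` as in the source; the
same constants are obtained for the pair correlation `⟨c†_{x↑} c†_{x↓} c_{y↓} c_{y↑}⟩_{β, L}`
(`onSitePair`).

## The printed proof and its transcription

Koma–Tasaki, PRL **68** (1992) 3248 = arXiv:cond-mat/9709068, pp. 3–4, for an observable `A`
and the Gibbs state `⟨A⟩ = Tr[A e^{-βH}] / Tr[e^{-βH}]` on a finite torus:

* (5)–(6) a non-unitary "gauge transformation" `G = Π exp[-i θ_{uσ} n_{uσ}]` with imaginary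
  angles, and `Tr[A e^{-βH}] = Tr[G A G⁻¹ e^{-β G H G⁻¹}]`. Here: `G = diagonal (s ↦ Π_{i ∈ s} w_i)`
  on the fermionic Fock space `ℂ^{Finset (Orb Λ)}` with weights `w_i = e^{v_i}`; it rescales
  `c†_i ↦ w_i c†_i`, `c_i ↦ w_i⁻¹ c_i` (`diagonal_prod_mul_creation`,
  `diagonal_prod_mul_annihilation`) and fixes the number operators (`gauge_conj_numberAt`).
  For the pair correlation the weights are `v_{(u,σ)} = -ψ u` (eq. (5) with `θ = -iφ`); for the
  magnetic case (last paragraph of the proof, "θ depends on σ") they are spin-dependent: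
  `v_{(u,↑)} = -ψ u`, `v_{(u,↓)} = +ψ u` (`sum_cosh_signGauge` treats both sign patterns).
* (7) `G H G⁻¹ = H + U + iP` with `U = -Σ t_{uv} (cosh (φ_u - φ_v) - 1) c†c`: here
  `gauge_conj_hamiltonianWith` (the hopping monomials pick up `e^{v_{xσ} - v_{yσ}}`, the
  interaction and `μ N` are fixed) and `gauge_hermitianPart_sub_hamiltonianWith`
  (`(H' + H'ᴴ)/2 - H = -t Σ (cosh (v_{xσ} - v_{yσ}) - 1) c†_{xσ} c_{yσ}`, i.e. `U`; the
  anti-Hermitian part `iP` is never needed separately).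
* (8) `G A G⁻¹ = e^{-2(φ_x - φ_y)} A`: here `gauge_conj_creation`, `gauge_conj_annihilation`,
  `gauge_conj_creation_mul_annihilation` and `gauge_conj_mul`, giving
  `κ = e^{v_{x↑} + v_{x↓} - v_{y↓} - v_{y↑}} = e^{-2(ψ x - ψ y)}` for `A = c†_{x↑} c†_{x↓} c_{y↓} c_{y↑}`
  and `κ = e^{v_{x↑} - v_{x↓}} e^{v_{y↓} - v_{y↑}} = e^{-2(ψ x - ψ y)}` for `A = S⁺_x S⁻_y`.
* (10) the chain of trace inequalities i)–iv) (Cauchy–Schwarz, `|Tr OP| ≤ ‖O‖ Tr P`,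
  `Tr[(O⋆)^N O^N] ≤ Tr[(O⋆O)^N]` with the Lie product formula, Golden–Thompson): this is the
  model-independent `Literature.MathematicalPhysics.QuantumLattice.koma_tasaki_trace_bound` of
  `TraceInequalitiesProofs.lean` (from the discharged named facts `goldenThompson`,
  `bernstein_trace_exp_mul_exp_conjTranspose_le` of `TraceInequalities.lean` and the Lie product
  formula of `LieTrotter.lean`), `|Tr (A e^{-H})| ≤ |κ| ‖A‖ e^{‖U‖} Tr e^{-H}`.
* (11) `‖e^{-βU}‖ ≤ exp [β Σ |t| (cosh (φ_u - φ_v) - 1)]` using `‖c†_u c_v‖ ≤ 1`: here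
  `norm_gauge_hermitianPart_sub_hamiltonianWith_le` with `l2_opNorm_creation_mul_annihilation_le_one`
  (`‖c_i‖, ‖c†_i‖ ≤ 1`: `norm_annihilation_le_one`, `norm_creation_le_one` of `HubbardGaugeBound`).
  Assembled: `norm_trace_mul_gibbsWeight_hamiltonianWith_le` (any graph `Λ`, any weights `v`),
  on the torus `norm_gibbsState_hubbardTorusWith_le`, and with the two sign patterns
  `norm_thermalCorr_onSitePair_le`, `norm_thermalCorr_siteSpinPlus_le`:
  `|⟨A⟩_{β,L}| ≤ e^{-2(ψ x - ψ y)} exp [2 β |t| Σ_u Σ_{u'} [u ∼ u'] (cosh (ψ u - ψ u') - 1)]`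
  for EVERY real function `ψ` on `(ℤ/Lℤ)^d` (eq. (12) before the choice of `φ`).
* (12)–(13) and P1, P2: the choice of the test function. The source takes `φ` = `q ×` the
  lattice Green function on the torus and quotes P1 (bounded gradient) and P2
  (`φ_x - φ_y ≥ q α ln |x - y|` in `d = 2`, `≥ q γ |x - y|` in `d = 1`, "in the `L → ∞` limit").
  Here the uniform-in-`L` statement is obtained from the explicit McBryan–Spencer profiles of
  `LatticeToriProofs.lean` (`exists_testFunction_two`: `ψ x - ψ y = q log (R + 1)`, energy
  `≤ 64 q² (log (R + 1) + 1)`; `exists_testFunction_one`: `q R`, energy `≤ 8 q² R`;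
  `R = dist (x, y)`), applied with `ψ/2` in place of `φ` bookkeeping (`-2 (ψ x - ψ y)` above), and
  the charge `q = 1 / (128 β |t| + 1)` resp. `1 / (16 β |t| + 1)`, for which
  `2 β |t| · 64 q² ≤ q` resp. `2 β |t| · 8 q² ≤ q` (`charge_ineq`), whence
  `|⟨A⟩| ≤ e^{-2q log (R+1) + q log (R+1) + q} ≤ e · (R + 1)^{-q}` resp. `≤ e^{-2qR + qR} = e^{-qR}`
  (`le_rpow_of_forall_testFunction_two`, `le_exp_of_forall_testFunction_one`).

A technical point of the transcription: the target statement elaborates the matrix algebra on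
`Finset (Orb (FermionTorus d L))` through the `DecidableEq (FermionTorus d L)` instance found by
instance resolution on the concrete type (`instDecidableEqLex`/`Fintype.decidablePiFintype`),
whereas the generic lemmas over a `[LinearOrder Λ]` carry `LinearOrder.toDecidableEq`; the two
are equal by `Subsingleton.elim` but not definitionally, so the torus lemmas
(`norm_gibbsState_hubbardTorusWith_le`, `norm_thermalCorr_onSitePair_le`,
`norm_thermalCorr_siteSpinPlus_le`) are stated for an arbitrary instance
`[DecidableEq (FermionTorus d L)]` and substitute it at the start of their proofs.

## Sources

T. Koma, H. Tasaki, *Decay of superconducting and magnetic correlations in one- and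
two-dimensional Hubbard models*, Phys. Rev. Lett. **68** (1992) 3248–3251
= arXiv:cond-mat/9709068 (held copy), Theorem (p. 2) and its proof, eqs. (5)–(13) (pp. 3–4),
magnetic case: last paragraph of the proof (p. 4). O. A. McBryan, T. Spencer, Comm. Math. Phys.
**53** (1977) 299 (the method and the logarithmic test function).

## Mathlib search

All model notions (`creation`, `annihilation`, `numberAt`, `hamiltonianWith`, `hubbardTorusWith`,
`siteSpinPlus`, `Matrix.gibbsState`, `Matrix.thermalCorr`, `torusDist`) come from the accepted
prelude, as do `isHermitian_hamiltonianWith`, `norm_annihilation_le_one`, `norm_creation_le_one`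
(`HubbardGaugeBound`, whose `gaugeMatrix θ` is the present `G_w` with `w = e^{-θ}`; the weight
form is kept here because the spin-dependent gauge of the magnetic case is not a `siteGauge`); Mathlib supplies `Matrix.diagonal`, the `L²` operator norm (`Matrix.l2_opNorm_diagonal`,
`Matrix.l2_opNorm_conjTranspose_mul_self`, `Matrix.l2_opNorm_mul`), `NormedSpace.exp`,
`Real.cosh`, `Real.rpow_def_of_pos`. `rg -i 'koma|mcbryan|golden.thompson'` over Mathlib: nothing.
-/

open scoped Matrix.Norms.L2Operator ComplexOrder

namespace Literature.MathematicalPhysics.QuantumLattice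

open Matrix Finset

/-! ### Diagonal (imaginary-angle) gauge transformations on the fermionic Fock space -/

section GaugeWeights

variable {ι : Type*} [LinearOrder ι] [Fintype ι]

/-- The diagonal gauge transformation `G_w = diagonal (s ↦ Π_{i ∈ s} w_i)` (nonzero weights)
rescales the annihilation operators: `G_w c_j = w_j⁻¹ c_j G_w` (Koma–Tasaki's `G(θ)` of eq. (5)
with `w = e^{-iθ}`, `θ` imaginary). Koma–Tasaki, PRL 68 (1992) 3248, eq. (5).
[cite: KomaTasakiPRL1992, eq. (5)] -/
theorem diagonal_prod_mul_annihilation (w : ι → ℂ) (hw : ∀ i, w i ≠ 0) (j : ι) :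
    diagonal (fun s : Finset ι => ∏ i ∈ s, w i) * annihilation j =
      (w j)⁻¹ • (annihilation j * diagonal (fun s : Finset ι => ∏ i ∈ s, w i)) := by
  ext s t
  rw [diagonal_mul, Matrix.smul_apply, mul_diagonal, smul_eq_mul]
  simp only [annihilation]
  split_ifs with h
  · obtain ⟨hj, rfl⟩ := h
    rw [prod_insert hj]
    field_simp [hw j]
  · simp

/-- The diagonal gauge transformation rescales the creation operators: `G_w c†_j = w_j c†_j G_w`.
Koma–Tasaki, PRL 68 (1992) 3248, eq. (5). [cite: KomaTasakiPRL1992, eq. (5)] -/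
theorem diagonal_prod_mul_creation (w : ι → ℂ) (j : ι) :
    diagonal (fun s : Finset ι => ∏ i ∈ s, w i) * creation j =
      (w j) • (creation j * diagonal (fun s : Finset ι => ∏ i ∈ s, w i)) := by
  ext s t
  rw [diagonal_mul, Matrix.smul_apply, mul_diagonal, smul_eq_mul]
  simp only [creation, conjTranspose_apply, annihilation]
  split_ifs with h
  · obtain ⟨hj, rfl⟩ := h
    rw [prod_insert hj]
    ring
  · simp

/-- `‖c†_a c_b‖ ≤ 1` in the operator norm (the input `‖c† c‖ ≤ 1` of Koma–Tasaki's eq. (11)).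
Koma–Tasaki, PRL 68 (1992) 3248, sentence after eq. (11). [folklore] -/
theorem l2_opNorm_creation_mul_annihilation_le_one (a b : ι) :
    ‖creation a * annihilation b‖ ≤ 1 := by
  calc _ ≤ ‖creation a‖ * ‖annihilation b‖ := l2_opNorm_mul _ _
    _ ≤ 1 * 1 := mul_le_mul (norm_creation_le_one a) (norm_annihilation_le_one b)
        (norm_nonneg _) zero_le_one
    _ = 1 := one_mul 1

/-- Diagonal gauge transformations compose weight-wise: `G_w G_{w'} = G_{w w'}`. [folklore] -/
theorem diagonal_prod_mul_diagonal_prod (w w' : ι → ℂ) :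
    diagonal (fun s : Finset ι => ∏ i ∈ s, w i) * diagonal (fun s : Finset ι => ∏ i ∈ s, w' i) =
      diagonal (fun s : Finset ι => ∏ i ∈ s, (w i * w' i)) := by
  rw [diagonal_mul_diagonal]
  congr 1
  funext s
  rw [prod_mul_distrib]

/-- `G_{e^{v}} G_{e^{-v}} = 1`. [folklore] -/
theorem diagonal_prod_exp_mul_diagonal_prod_exp_neg (v : ι → ℝ) :
    diagonal (fun s : Finset ι => ∏ i ∈ s, (Real.exp (v i) : ℂ)) *
        diagonal (fun s : Finset ι => ∏ i ∈ s, (Real.exp (-v i) : ℂ)) = 1 := by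
  rw [diagonal_prod_mul_diagonal_prod]
  convert diagonal_one with s
  refine prod_eq_one fun i _ => ?_
  rw [← Complex.ofReal_mul, ← Real.exp_add, add_neg_cancel, Real.exp_zero, Complex.ofReal_one]

/-- `G_{e^{-v}} G_{e^{v}} = 1`. [folklore] -/
theorem diagonal_prod_exp_neg_mul_diagonal_prod_exp (v : ι → ℝ) :
    diagonal (fun s : Finset ι => ∏ i ∈ s, (Real.exp (-v i) : ℂ)) *
        diagonal (fun s : Finset ι => ∏ i ∈ s, (Real.exp (v i) : ℂ)) = 1 := by
  have := diagonal_prod_exp_mul_diagonal_prod_exp_neg (fun i => -v i)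
  simpa using this

/-- The diagonal gauge transformation commutes with the number operators `n_j` (both are
diagonal in the occupation basis). Koma–Tasaki, PRL 68 (1992) 3248, eq. (7) (the interaction is
gauge invariant). [folklore] -/
theorem diagonal_prod_mul_numberAt (w : ι → ℂ) (j : ι) :
    diagonal (fun s : Finset ι => ∏ i ∈ s, w i) * numberAt j =
      numberAt j * diagonal (fun s : Finset ι => ∏ i ∈ s, w i) := by
  rw [numberAt_eq_diagonal, diagonal_mul_diagonal, diagonal_mul_diagonal]
  congr 1; funext s; ring

/-- **Gauge transformation of a hopping monomial**: `G_{e^v} (c†_a c_b) G_{e^v}⁻¹ = e^{v_a - v_b} c†_a c_b`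
(Koma–Tasaki eq. (7) for the hopping term and eq. (8) for the observable).
Koma–Tasaki, PRL 68 (1992) 3248, eqs. (7), (8). [cite: KomaTasakiPRL1992, eqs. (7)–(8)] -/
theorem gauge_conj_creation_mul_annihilation (v : ι → ℝ) (a b : ι) :
    diagonal (fun s : Finset ι => ∏ i ∈ s, (Real.exp (v i) : ℂ)) * (creation a * annihilation b) *
        diagonal (fun s : Finset ι => ∏ i ∈ s, (Real.exp (-v i) : ℂ)) =
      (Real.exp (v a - v b) : ℂ) • (creation a * annihilation b) := by
  set W := diagonal (fun s : Finset ι => ∏ i ∈ s, (Real.exp (v i) : ℂ)) with hW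
  set W' := diagonal (fun s : Finset ι => ∏ i ∈ s, (Real.exp (-v i) : ℂ)) with hW'
  have hw : ∀ i, (Real.exp (v i) : ℂ) ≠ 0 := fun i =>
    Complex.ofReal_ne_zero.mpr (Real.exp_pos _).ne'
  have h1 : W * creation a = (Real.exp (v a) : ℂ) • (creation a * W) :=
    diagonal_prod_mul_creation _ a
  have h2 : W * annihilation b = ((Real.exp (v b) : ℂ))⁻¹ • (annihilation b * W) :=
    diagonal_prod_mul_annihilation _ hw b
  have h3 : W * W' = 1 := diagonal_prod_exp_mul_diagonal_prod_exp_neg v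
  calc W * (creation a * annihilation b) * W'
      = (W * creation a) * annihilation b * W' := by noncomm_ring
    _ = ((Real.exp (v a) : ℂ) • (creation a * W)) * annihilation b * W' := by rw [h1]
    _ = (Real.exp (v a) : ℂ) • (creation a * (W * annihilation b) * W') := by
        simp only [smul_mul_assoc, mul_assoc]
    _ = (Real.exp (v a) : ℂ) • (creation a * (((Real.exp (v b) : ℂ))⁻¹ • (annihilation b * W)) * W') := by
        rw [h2]
    _ = ((Real.exp (v a) : ℂ) * ((Real.exp (v b) : ℂ))⁻¹) •
          (creation a * annihilation b * (W * W')) := by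
        simp only [mul_smul_comm, smul_mul_assoc, smul_smul, mul_assoc]
    _ = _ := by
        rw [h3, mul_one, Real.exp_sub, Complex.ofReal_div, div_eq_mul_inv]

/-- The number operators are gauge invariant: `G_{e^v} n_j G_{e^v}⁻¹ = n_j`.
Koma–Tasaki, PRL 68 (1992) 3248, eq. (7). [cite: KomaTasakiPRL1992, eq. (7)] -/
theorem gauge_conj_numberAt (v : ι → ℝ) (j : ι) :
    diagonal (fun s : Finset ι => ∏ i ∈ s, (Real.exp (v i) : ℂ)) * numberAt j *
        diagonal (fun s : Finset ι => ∏ i ∈ s, (Real.exp (-v i) : ℂ)) = numberAt j := by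
  rw [diagonal_prod_mul_numberAt, mul_assoc, diagonal_prod_exp_mul_diagonal_prod_exp_neg, mul_one]

/-- The on-site interaction is gauge invariant: `G_{e^v} (n_j n_k) G_{e^v}⁻¹ = n_j n_k`.
Koma–Tasaki, PRL 68 (1992) 3248, eq. (7). [cite: KomaTasakiPRL1992, eq. (7)] -/
theorem gauge_conj_numberAt_mul_numberAt (v : ι → ℝ) (j k : ι) :
    diagonal (fun s : Finset ι => ∏ i ∈ s, (Real.exp (v i) : ℂ)) * (numberAt j * numberAt k) *
        diagonal (fun s : Finset ι => ∏ i ∈ s, (Real.exp (-v i) : ℂ)) = numberAt j * numberAt k := by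
  rw [← mul_assoc, diagonal_prod_mul_numberAt, mul_assoc (numberAt j), diagonal_prod_mul_numberAt,
    mul_assoc, mul_assoc, diagonal_prod_exp_mul_diagonal_prod_exp_neg, mul_one]

/-- Gauge transformation of a single creation operator: `G_{e^v} c†_a G_{e^v}⁻¹ = e^{v_a} c†_a`.
Koma–Tasaki, PRL 68 (1992) 3248, eq. (5). [cite: KomaTasakiPRL1992, eq. (5)] -/
theorem gauge_conj_creation (v : ι → ℝ) (a : ι) :
    diagonal (fun s : Finset ι => ∏ i ∈ s, (Real.exp (v i) : ℂ)) * creation a *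
        diagonal (fun s : Finset ι => ∏ i ∈ s, (Real.exp (-v i) : ℂ)) =
      (Real.exp (v a) : ℂ) • creation a := by
  rw [diagonal_prod_mul_creation, smul_mul_assoc, mul_assoc,
    diagonal_prod_exp_mul_diagonal_prod_exp_neg, mul_one]

/-- Gauge transformation of a single annihilation operator: `G_{e^v} c_b G_{e^v}⁻¹ = e^{-v_b} c_b`.
Koma–Tasaki, PRL 68 (1992) 3248, eq. (5). [cite: KomaTasakiPRL1992, eq. (5)] -/
theorem gauge_conj_annihilation (v : ι → ℝ) (b : ι) :
    diagonal (fun s : Finset ι => ∏ i ∈ s, (Real.exp (v i) : ℂ)) * annihilation b *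
        diagonal (fun s : Finset ι => ∏ i ∈ s, (Real.exp (-v i) : ℂ)) =
      (Real.exp (-v b) : ℂ) • annihilation b := by
  have hw : ∀ i, (Real.exp (v i) : ℂ) ≠ 0 := fun i =>
    Complex.ofReal_ne_zero.mpr (Real.exp_pos _).ne'
  rw [diagonal_prod_mul_annihilation _ hw, smul_mul_assoc, mul_assoc,
    diagonal_prod_exp_mul_diagonal_prod_exp_neg, mul_one, Real.exp_neg, Complex.ofReal_inv]

/-- Gauge eigen-operators multiply: if `G A G⁻¹ = κ A` and `G B G⁻¹ = κ' B` then
`G (A B) G⁻¹ = (κ κ') (A B)`. Koma–Tasaki, PRL 68 (1992) 3248, eq. (8). [folklore] -/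
theorem gauge_conj_mul (v : ι → ℝ) {A B : Matrix (Finset ι) (Finset ι) ℂ} {κ κ' : ℂ}
    (hA : diagonal (fun s : Finset ι => ∏ i ∈ s, (Real.exp (v i) : ℂ)) * A *
        diagonal (fun s : Finset ι => ∏ i ∈ s, (Real.exp (-v i) : ℂ)) = κ • A)
    (hB : diagonal (fun s : Finset ι => ∏ i ∈ s, (Real.exp (v i) : ℂ)) * B *
        diagonal (fun s : Finset ι => ∏ i ∈ s, (Real.exp (-v i) : ℂ)) = κ' • B) :
    diagonal (fun s : Finset ι => ∏ i ∈ s, (Real.exp (v i) : ℂ)) * (A * B) *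
        diagonal (fun s : Finset ι => ∏ i ∈ s, (Real.exp (-v i) : ℂ)) = (κ * κ') • (A * B) := by
  set W := diagonal (fun s : Finset ι => ∏ i ∈ s, (Real.exp (v i) : ℂ)) with hW
  set W' := diagonal (fun s : Finset ι => ∏ i ∈ s, (Real.exp (-v i) : ℂ)) with hW'
  have h2 : W' * W = 1 := diagonal_prod_exp_neg_mul_diagonal_prod_exp v
  calc W * (A * B) * W' = W * A * (W' * W) * B * W' := by rw [h2]; noncomm_ring
    _ = (W * A * W') * (W * B * W') := by noncomm_ring
    _ = (κ * κ') • (A * B) := by rw [hA, hB, smul_mul_smul_comm]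

end GaugeWeights

/-! ### The gauge-transformed Hubbard Hamiltonian -/

section Hubbard

variable {Λ : Type*} [LinearOrder Λ] [Fintype Λ] (G : SimpleGraph Λ) [DecidableRel G.Adj]

/-- The adjoint of a weighted hopping sum `Σ_{x ∼ y, σ} κ_{xyσ} c†_{xσ} c_{yσ}` over a symmetric
graph is the hopping sum with weights `conj κ_{yxσ}`. [folklore] -/
theorem conjTranspose_hoppingSum (κ : Λ → Λ → Fin 2 → ℂ) :
    (∑ x, ∑ y, ∑ σ : Fin 2, if G.Adj x y then
        κ x y σ • (creation (orb x σ) * annihilation (orb y σ)) else 0)ᴴ =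
      ∑ x, ∑ y, ∑ σ : Fin 2, if G.Adj x y then
        star (κ y x σ) • (creation (orb x σ) * annihilation (orb y σ)) else 0 := by
  simp only [conjTranspose_sum]
  rw [Finset.sum_comm]
  refine sum_congr rfl fun x _ => sum_congr rfl fun y _ => sum_congr rfl fun σ _ => ?_
  by_cases h : G.Adj x y
  · rw [if_pos h, if_pos (G.adj_symm h), conjTranspose_smul, conjTranspose_mul,
      creation_conjTranspose, annihilation_conjTranspose]
  · have h' : ¬ G.Adj y x := fun h' => h (G.adj_symm h')
    rw [if_neg h, if_neg h', conjTranspose_zero]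

/-- **Gauge transformation of the Hubbard Hamiltonian** (Koma–Tasaki eq. (7)):
`G_{e^v} (H - μN) G_{e^v}⁻¹ = -t Σ_{x ∼ y, σ} e^{v_{xσ} - v_{yσ}} c†_{xσ} c_{yσ} + U Σ_x n_{x↑} n_{x↓} - μ N`.
Koma–Tasaki, PRL 68 (1992) 3248, eq. (7). [cite: KomaTasakiPRL1992, eq. (7)] -/
theorem gauge_conj_hamiltonianWith (v : Orb Λ → ℝ) (t U μ : ℝ) :
    diagonal (fun s : Finset (Orb Λ) => ∏ i ∈ s, (Real.exp (v i) : ℂ)) * hamiltonianWith G t U μ *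
        diagonal (fun s : Finset (Orb Λ) => ∏ i ∈ s, (Real.exp (-v i) : ℂ)) =
      -(t : ℂ) • (∑ x, ∑ y, ∑ σ : Fin 2, if G.Adj x y then
          (Real.exp (v (orb x σ) - v (orb y σ)) : ℂ) • (creation (orb x σ) * annihilation (orb y σ))
          else 0) +
        (U : ℂ) • (∑ x : Λ, numberOp x 0 * numberOp x 1) - (μ : ℂ) • totalNumber := by
  rw [hamiltonianWith, hamiltonian]
  simp only [QuantumLattice.totalNumber, mul_add, add_mul, mul_sub, sub_mul, Matrix.mul_smul,
    Matrix.smul_mul, Finset.mul_sum, Finset.sum_mul, mul_ite, ite_mul, zero_mul, mul_zero,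
    gauge_conj_creation_mul_annihilation, QuantumLattice.numberOp, ← numberAt.eq_1, gauge_conj_numberAt,
    gauge_conj_numberAt_mul_numberAt]

/-- The on-site interaction `Σ_x n_{x↑} n_{x↓}` is Hermitian. Tasaki (2020) §9.3. [folklore] -/
theorem conjTranspose_interaction :
    (∑ x : Λ, numberOp x 0 * numberOp x 1 : Matrix (Finset (Orb Λ)) _ ℂ)ᴴ =
      ∑ x : Λ, numberOp x 0 * numberOp x 1 := by
  rw [conjTranspose_sum]
  refine sum_congr rfl fun x _ => ?_
  rw [conjTranspose_mul, ← numberAt_orb, ← numberAt_orb, (numberAt_isHermitian _).eq,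
    (numberAt_isHermitian _).eq, (numberAt_commute _ _).eq]

/-- The total number operator `N` is Hermitian. Tasaki (2020) §9.2. [folklore] -/
theorem conjTranspose_totalNumber :
    (totalNumber : Matrix (Finset (Orb Λ)) _ ℂ)ᴴ = totalNumber := by
  simp only [QuantumLattice.totalNumber, conjTranspose_sum]
  refine sum_congr rfl fun x _ => sum_congr rfl fun σ _ => ?_
  rw [← numberAt_orb, (numberAt_isHermitian _).eq]

/-- **The Hermitian part of the gauge-transformed Hamiltonian** (Koma–Tasaki eqs. (7), (9)): with
`H' = G_{e^v} (H - μN) G_{e^v}⁻¹ = (H - μN) + U + iP`, the perturbation is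
`U = (H' + H'ᴴ)/2 - (H - μN) = -t Σ_{x ∼ y, σ} (cosh (v_{xσ} - v_{yσ}) - 1) c†_{xσ} c_{yσ}`.
Koma–Tasaki, PRL 68 (1992) 3248, eqs. (7), (9). [cite: KomaTasakiPRL1992, eqs. (7) and (9)] -/
theorem gauge_hermitianPart_sub_hamiltonianWith (v : Orb Λ → ℝ) (t U μ : ℝ) :
    (2 : ℂ)⁻¹ • ((diagonal (fun s : Finset (Orb Λ) => ∏ i ∈ s, (Real.exp (v i) : ℂ)) *
        hamiltonianWith G t U μ *
        diagonal (fun s : Finset (Orb Λ) => ∏ i ∈ s, (Real.exp (-v i) : ℂ))) +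
      (diagonal (fun s : Finset (Orb Λ) => ∏ i ∈ s, (Real.exp (v i) : ℂ)) *
        hamiltonianWith G t U μ *
        diagonal (fun s : Finset (Orb Λ) => ∏ i ∈ s, (Real.exp (-v i) : ℂ)))ᴴ) -
      hamiltonianWith G t U μ =
    -(t : ℂ) • ∑ x, ∑ y, ∑ σ : Fin 2, if G.Adj x y then
        ((Real.cosh (v (orb x σ) - v (orb y σ)) - 1 : ℝ) : ℂ) •
          (creation (orb x σ) * annihilation (orb y σ)) else 0 := by
  rw [gauge_conj_hamiltonianWith]
  have hH : hamiltonianWith G t U μ = -(t : ℂ) • (∑ x, ∑ y, ∑ σ : Fin 2, if G.Adj x y then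
      creation (orb x σ) * annihilation (orb y σ) else 0) +
      (U : ℂ) • (∑ x : Λ, numberOp x 0 * numberOp x 1) - (μ : ℂ) • totalNumber := by
    rw [hamiltonianWith, hamiltonian]
  have hT := conjTranspose_hoppingSum G (fun x y σ => (Real.exp (v (orb x σ) - v (orb y σ)) : ℂ))
  simp only [Complex.star_def, Complex.conj_ofReal] at hT
  rw [conjTranspose_sub, conjTranspose_add, conjTranspose_smul, conjTranspose_smul,
    conjTranspose_smul, hT, conjTranspose_interaction, conjTranspose_totalNumber, hH]
  simp only [Complex.star_def, Complex.conj_ofReal, map_neg]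
  -- linear algebra of the four sums
  set T₁ := ∑ x, ∑ y, ∑ σ : Fin 2, if G.Adj x y then
      (Real.exp (v (orb x σ) - v (orb y σ)) : ℂ) • (creation (orb x σ) * annihilation (orb y σ))
      else (0 : Matrix (Finset (Orb Λ)) _ ℂ) with hT₁
  set T₂ := ∑ x, ∑ y, ∑ σ : Fin 2, if G.Adj x y then
      (Real.exp (v (orb y σ) - v (orb x σ)) : ℂ) • (creation (orb x σ) * annihilation (orb y σ))
      else (0 : Matrix (Finset (Orb Λ)) _ ℂ) with hT₂
  set T₀ := ∑ x, ∑ y, ∑ σ : Fin 2, if G.Adj x y then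
      creation (orb x σ) * annihilation (orb y σ) else (0 : Matrix (Finset (Orb Λ)) _ ℂ) with hT₀
  set I := (∑ x : Λ, numberOp x 0 * numberOp x 1 : Matrix (Finset (Orb Λ)) _ ℂ) with hI
  set N := (totalNumber : Matrix (Finset (Orb Λ)) _ ℂ) with hN
  have step : (2 : ℂ)⁻¹ • ((-(t : ℂ) • T₁ + (U : ℂ) • I - (μ : ℂ) • N) +
      (-(t : ℂ) • T₂ + (U : ℂ) • I - (μ : ℂ) • N)) - (-(t : ℂ) • T₀ + (U : ℂ) • I - (μ : ℂ) • N) =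
      -(t : ℂ) • ((2 : ℂ)⁻¹ • T₁ + (2 : ℂ)⁻¹ • T₂ - T₀) := by
    module
  rw [step]
  congr 1
  simp only [hT₁, hT₂, hT₀, Finset.smul_sum, ← Finset.sum_add_distrib, ← Finset.sum_sub_distrib]
  refine sum_congr rfl fun x _ => sum_congr rfl fun y _ => sum_congr rfl fun σ _ => ?_
  split_ifs with h
  · have key : ∀ (a b : ℂ) (X : Matrix (Finset (Orb Λ)) (Finset (Orb Λ)) ℂ),
        (2 : ℂ)⁻¹ • (a • X) + (2 : ℂ)⁻¹ • (b • X) - X = ((2 : ℂ)⁻¹ * a + (2 : ℂ)⁻¹ * b - 1) • X := by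
      intro a b X; module
    rw [key]
    congr 1
    rw [show v (orb y σ) - v (orb x σ) = -(v (orb x σ) - v (orb y σ)) by ring, Real.cosh_eq]
    push_cast
    ring
  · simp

/-- The operator norm of a weighted hopping sum is at most the sum of the absolute weights
(`‖c†_{xσ} c_{yσ}‖ ≤ 1`). Koma–Tasaki, PRL 68 (1992) 3248, sentence after eq. (11). [folklore] -/
theorem norm_hoppingSum_le (c : Λ → Λ → Fin 2 → ℂ) :
    ‖∑ x, ∑ y, ∑ σ : Fin 2, if G.Adj x y then
        c x y σ • (creation (orb x σ) * annihilation (orb y σ)) else (0 : Matrix _ _ ℂ)‖ ≤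
      ∑ x, ∑ y, ∑ σ : Fin 2, if G.Adj x y then ‖c x y σ‖ else 0 := by
  refine (norm_sum_le _ _).trans (sum_le_sum fun x _ => ?_)
  refine (norm_sum_le _ _).trans (sum_le_sum fun y _ => ?_)
  refine (norm_sum_le _ _).trans (sum_le_sum fun σ _ => ?_)
  split_ifs with h
  · calc _ ≤ ‖c x y σ‖ * ‖creation (orb x σ) * annihilation (orb y σ)‖ := norm_smul_le _ _
      _ ≤ ‖c x y σ‖ * 1 := by
          gcongr; exact l2_opNorm_creation_mul_annihilation_le_one _ _
      _ = _ := mul_one _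
  · simp

/-- **Norm of the Koma–Tasaki perturbation** (eq. (11), first inequality, before the bound on
`cosh - 1`): `‖U‖ ≤ |t| Σ_{x ∼ y, σ} (cosh (v_{xσ} - v_{yσ}) - 1)`.
Koma–Tasaki, PRL 68 (1992) 3248, eq. (11). [cite: KomaTasakiPRL1992, eq. (11)] -/
theorem norm_gauge_hermitianPart_sub_hamiltonianWith_le (v : Orb Λ → ℝ) (t U μ : ℝ) :
    ‖(2 : ℂ)⁻¹ • ((diagonal (fun s : Finset (Orb Λ) => ∏ i ∈ s, (Real.exp (v i) : ℂ)) *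
        hamiltonianWith G t U μ *
        diagonal (fun s : Finset (Orb Λ) => ∏ i ∈ s, (Real.exp (-v i) : ℂ))) +
      (diagonal (fun s : Finset (Orb Λ) => ∏ i ∈ s, (Real.exp (v i) : ℂ)) *
        hamiltonianWith G t U μ *
        diagonal (fun s : Finset (Orb Λ) => ∏ i ∈ s, (Real.exp (-v i) : ℂ)))ᴴ) -
      hamiltonianWith G t U μ‖ ≤
    |t| * ∑ x, ∑ y, ∑ σ : Fin 2, if G.Adj x y then
        (Real.cosh (v (orb x σ) - v (orb y σ)) - 1) else 0 := by
  rw [gauge_hermitianPart_sub_hamiltonianWith, norm_smul, norm_neg, Complex.norm_real,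
    Real.norm_eq_abs]
  gcongr
  refine (norm_hoppingSum_le G _).trans (le_of_eq ?_)
  refine sum_congr rfl fun x _ => sum_congr rfl fun y _ => sum_congr rfl fun σ _ => ?_
  split_ifs with h
  · rw [Complex.norm_real, Real.norm_eq_abs, abs_of_nonneg]
    linarith [Real.one_le_cosh (v (orb x σ) - v (orb y σ))]
  · rfl

end Hubbard

end Literature.MathematicalPhysics.QuantumLattice

/-! ### Assembly: the Koma–Tasaki bound for the Hubbard Gibbs weight -/

namespace Literature.MathematicalPhysics.QuantumLattice

open Matrix Finset NormedSpace
open scoped Matrix.Norms.L2Operator ComplexOrder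

section FermionKT

variable {Λ : Type*} [LinearOrder Λ] [Fintype Λ] (G : SimpleGraph Λ) [DecidableRel G.Adj]

/-- **Koma–Tasaki bound for the Hubbard Gibbs weight** (fermionic form of eqs. (6)–(11)): for
any finite graph, real weights `v` on the orbitals, `β ≥ 0`, and an observable `A` with
`G_{e^v} A G_{e^v}⁻¹ = κ A`,
`|Tr (A e^{-β(H - μN)})| ≤ |κ| ‖A‖ exp [β |t| Σ_{x ∼ y, σ} (cosh (v_{xσ} - v_{yσ}) - 1)] Tr e^{-β(H - μN)}`
(`koma_tasaki_trace_bound` with `‖βU‖` bounded by `norm_gauge_hermitianPart_sub_hamiltonianWith_le`).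
Koma–Tasaki, PRL 68 (1992) 3248, eqs. (6), (10), (11). [cite: KomaTasakiPRL1992, eqs. (6)–(11)] -/
theorem norm_trace_mul_gibbsWeight_hamiltonianWith_le (v : Orb Λ → ℝ) (t U μ β : ℝ)
    (hβ : 0 ≤ β) (A : Matrix (Finset (Orb Λ)) (Finset (Orb Λ)) ℂ) (κ : ℂ)
    (hA : diagonal (fun s : Finset (Orb Λ) => ∏ i ∈ s, (Real.exp (v i) : ℂ)) * A *
        diagonal (fun s : Finset (Orb Λ) => ∏ i ∈ s, (Real.exp (-v i) : ℂ)) = κ • A) :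
    ‖(A * exp (-(β : ℂ) • hamiltonianWith G t U μ)).trace‖ ≤
      ‖κ‖ * ‖A‖ * Real.exp (β * (|t| * ∑ x, ∑ y, ∑ σ : Fin 2, if G.Adj x y then
        (Real.cosh (v (orb x σ) - v (orb y σ)) - 1) else 0)) *
        ((exp (-(β : ℂ) • hamiltonianWith G t U μ)).trace).re := by
  set W : Matrix (Finset (Orb Λ)) (Finset (Orb Λ)) ℂ :=
    diagonal (fun s : Finset (Orb Λ) => ∏ i ∈ s, (Real.exp (v i) : ℂ)) with hW
  set W' : Matrix (Finset (Orb Λ)) (Finset (Orb Λ)) ℂ :=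
    diagonal (fun s : Finset (Orb Λ) => ∏ i ∈ s, (Real.exp (-v i) : ℂ)) with hW'
  have h1 : W * W' = 1 := diagonal_prod_exp_mul_diagonal_prod_exp_neg v
  have h2 : W' * W = 1 := diagonal_prod_exp_neg_mul_diagonal_prod_exp v
  let Gu : (Matrix (Finset (Orb Λ)) (Finset (Orb Λ)) ℂ)ˣ := ⟨W, W', h1, h2⟩
  set H : Matrix (Finset (Orb Λ)) (Finset (Orb Λ)) ℂ := hamiltonianWith G t U μ with hH
  have hHh : H.IsHermitian := isHermitian_hamiltonianWith G t U μ
  have hβH : ((β : ℂ) • H).IsHermitian := isHermitian_real_smul hHh β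
  have key := koma_tasaki_trace_bound hβH Gu A κ hA
  have hneg : -((β : ℂ) • H) = -(β : ℂ) • H := (neg_smul _ _).symm
  rw [hneg] at key
  refine key.trans ?_
  have hUn : ‖(2 : ℂ)⁻¹ • ((Gu : Matrix _ _ ℂ) * ((β : ℂ) • H) * ((Gu⁻¹ : (Matrix _ _ ℂ)ˣ) : Matrix _ _ ℂ) +
      ((Gu : Matrix _ _ ℂ) * ((β : ℂ) • H) * ((Gu⁻¹ : (Matrix _ _ ℂ)ˣ) : Matrix _ _ ℂ))ᴴ) - (β : ℂ) • H‖ ≤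
      β * (|t| * ∑ x, ∑ y, ∑ σ : Fin 2, if G.Adj x y then
        (Real.cosh (v (orb x σ) - v (orb y σ)) - 1) else 0) := by
    have hGu : (Gu : Matrix _ _ ℂ) = W := rfl
    have hGu' : ((Gu⁻¹ : (Matrix _ _ ℂ)ˣ) : Matrix _ _ ℂ) = W' := rfl
    rw [hGu, hGu']
    have hs : star (β : ℂ) = β := by simp
    have hcalc : (2 : ℂ)⁻¹ • (W * ((β : ℂ) • H) * W' + (W * ((β : ℂ) • H) * W')ᴴ) - (β : ℂ) • H =
        (β : ℂ) • ((2 : ℂ)⁻¹ • (W * H * W' + (W * H * W')ᴴ) - H) := by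
      rw [Matrix.mul_smul, Matrix.smul_mul, conjTranspose_smul, hs, ← smul_add, smul_comm,
        ← smul_sub]
    rw [hcalc, norm_smul, Complex.norm_real, Real.norm_eq_abs, abs_of_nonneg hβ]
    exact mul_le_mul_of_nonneg_left
      (norm_gauge_hermitianPart_sub_hamiltonianWith_le G v t U μ) hβ
  have htr : 0 ≤ ((exp (-(β : ℂ) • H)).trace).re := by
    rw [← hneg, Complex.re_eq_norm.mpr (posSemidef_exp_of_isHermitian hβH.neg).trace_nonneg]
    exact norm_nonneg _
  gcongr

end FermionKT

end Literature.MathematicalPhysics.QuantumLattice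

/-! ### The magnetic correlation on the torus -/

namespace Literature.MathematicalPhysics.QuantumLattice

open Matrix Finset Literature.Probability.LatticeModels NormedSpace
open scoped Matrix.Norms.L2Operator ComplexOrder

section KomaTasakiProof

/-- From a trace bound to a bound on the Gibbs state: if `|Tr (A e^{-βH})| ≤ K Tr e^{-βH}` for a
Hermitian `H`, then `|⟨A⟩_β| ≤ K` (`Matrix.gibbsState`; `Tr e^{-βH} > 0`).
Koma–Tasaki, PRL 68 (1992) 3248, eq. (12). [folklore] -/
theorem norm_gibbsState_le_of_trace_bound {n : Type*} [Fintype n] [DecidableEq n] [Nonempty n]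
    {H : Matrix n n ℂ} (hH : H.IsHermitian) (β : ℝ) (A : Matrix n n ℂ) {K : ℝ}
    (hK : ‖(A * exp (-(β : ℂ) • H)).trace‖ ≤ K * ((exp (-(β : ℂ) • H)).trace).re) :
    ‖gibbsState β H A‖ ≤ K := by
  have hZ : 0 < partitionFn β H := partitionFn_pos β hH
  have hZre : 0 < (partitionFn β H).re := (Complex.lt_def.mp hZ).1
  have hZn : ‖partitionFn β H‖ = (partitionFn β H).re := (Complex.re_eq_norm.mpr hZ.le).symm
  have h1 : (gibbsWeight β H * A).trace = (A * exp (-(β : ℂ) • H)).trace := by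
    rw [trace_mul_comm]; rfl
  have h2 : partitionFn β H = (exp (-(β : ℂ) • H)).trace := rfl
  rw [gibbsState_apply, norm_mul, norm_inv, hZn, inv_mul_le_iff₀ hZre, h1, h2, mul_comm]
  exact hK

variable {d L : ℕ} [NeZero L]

omit [NeZero L] in
/-- **Koma–Tasaki bound for the torus Hubbard Gibbs state of a gauge eigen-operator**: for real
weights `v` on the orbitals of the fermionic torus, `β ≥ 0`, and an observable `A` with
`‖A‖ ≤ 1` and `G_{e^v} A G_{e^v}⁻¹ = κ A`,
`|⟨A⟩_{β,L}| ≤ |κ| exp [β |t| Σ_{x' ∼ y', σ} (cosh (v_{x'σ} - v_{y'σ}) - 1)]` (eqs. (6)–(12)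
before the choice of the weights). Stated for an arbitrary `[DecidableEq (FermionTorus d L)]`
instance (see the module docstring). Koma–Tasaki, PRL 68 (1992) 3248, eqs. (6)–(12).
[cite: KomaTasakiPRL1992, eqs. (6)–(12)] -/
theorem norm_gibbsState_hubbardTorusWith_le [instDE : DecidableEq (FermionTorus d L)]
    (t U μ β : ℝ) (hβ : 0 ≤ β) (v : Orb (FermionTorus d L) → ℝ)
    (A : Matrix (Finset (Orb (FermionTorus d L))) (Finset (Orb (FermionTorus d L))) ℂ) (κ : ℂ)
    (hA : diagonal (fun s : Finset (Orb (FermionTorus d L)) => ∏ i ∈ s, (Real.exp (v i) : ℂ)) *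
        A * diagonal (fun s : Finset (Orb (FermionTorus d L)) => ∏ i ∈ s, (Real.exp (-v i) : ℂ)) =
        κ • A)
    (hAn : ‖A‖ ≤ 1) :
    ‖gibbsState β (hubbardTorusWith d L t U μ) A‖ ≤
      ‖κ‖ * Real.exp (β * (|t| * ∑ x', ∑ y', ∑ σ : Fin 2,
        if (fermionTorusGraph d L).Adj x' y' then
          (Real.cosh (v (orb x' σ) - v (orb y' σ)) - 1) else 0)) := by
  -- Replace the ambient `DecidableEq (FermionTorus d L)` instance (through which every matrix
  -- unit, `diagonal` and `exp` in sight is elaborated) by the one carried by the generic lemmas,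
  -- `LinearOrder.toDecidableEq`; the two agree by `Subsingleton.elim`.
  obtain rfl : instDE = LinearOrder.toDecidableEq := Subsingleton.elim _ _
  letI instDE : DecidableEq (FermionTorus d L) := LinearOrder.toDecidableEq
  have key := norm_trace_mul_gibbsWeight_hamiltonianWith_le (fermionTorusGraph d L) v t U μ β hβ
    A κ hA
  have hH : (hubbardTorusWith d L t U μ).IsHermitian := isHermitian_hamiltonianWith _ t U μ
  refine norm_gibbsState_le_of_trace_bound hH β A (key.trans ?_)
  have htr : 0 ≤ ((exp (-(β : ℂ) • hamiltonianWith (fermionTorusGraph d L) t U μ)).trace).re := by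
    have hβH : (-(β : ℂ) • hamiltonianWith (fermionTorusGraph d L) t U μ).IsHermitian := by
      have := isHermitian_real_smul (isHermitian_hamiltonianWith (fermionTorusGraph d L) t U μ) (-β)
      simpa using this
    rw [Complex.re_eq_norm.mpr (posSemidef_exp_of_isHermitian hβH).trace_nonneg]
    exact norm_nonneg _
  calc _ ≤ ‖κ‖ * 1 * Real.exp (β * (|t| * ∑ x', ∑ y', ∑ σ : Fin 2,
        if (fermionTorusGraph d L).Adj x' y' then
          (Real.cosh (v (orb x' σ) - v (orb y' σ)) - 1) else 0)) *
        ((exp (-(β : ℂ) • hamiltonianWith (fermionTorusGraph d L) t U μ)).trace).re := by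
        gcongr
    _ = _ := by rw [mul_one]; rfl

/-- The weights built from a real function `ψ` on the torus and a sign pattern `ε : Fin 2 → ℝ`
(`v_{(u,σ)} = ε σ · ψ u` with `ε σ = ±1`) have energy
`Σ_{x' ∼ y', σ} (cosh (v_{x'σ} - v_{y'σ}) - 1) = 2 Σ_u Σ_{u'} [u ∼ u'] (cosh (ψ u - ψ u') - 1)`
(`cosh` is even; the fermionic torus graph is the comap of `torusGraph` along
`FermionTorus.toTorusSite`). The charge gauge of eq. (5) is `ε ≡ -1`, the spin-dependent gauge
of the magnetic case is `ε = (-1, +1)`. Koma–Tasaki, PRL 68 (1992) 3248, eq. (5) and the last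
paragraph of the proof. [folklore] -/
theorem sum_cosh_signGauge (ε : Fin 2 → ℝ) (hε : ∀ σ, ε σ = 1 ∨ ε σ = -1)
    (ψ : TorusSite d L → ℝ) :
    (∑ x' : FermionTorus d L, ∑ y' : FermionTorus d L, ∑ σ : Fin 2,
      if (fermionTorusGraph d L).Adj x' y' then
        (Real.cosh ((fun i : Orb (FermionTorus d L) =>
            ε (ofLex i).2 * ψ (FermionTorus.toTorusSite (ofLex i).1)) (orb x' σ) -
          (fun i : Orb (FermionTorus d L) =>
            ε (ofLex i).2 * ψ (FermionTorus.toTorusSite (ofLex i).1)) (orb y' σ)) - 1) else 0) =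
      2 * ∑ u, ∑ u', (if (torusGraph d L).Adj u u' then Real.cosh (ψ u - ψ u') - 1 else 0) := by
  have hcosh : ∀ (σ : Fin 2) (a b : ℝ), Real.cosh (ε σ * a - ε σ * b) = Real.cosh (a - b) := by
    intro σ a b
    rcases hε σ with h | h
    · rw [h, one_mul, one_mul]
    · rw [h, ← Real.cosh_neg]; ring_nf
  have hσ : ∀ x' y' : FermionTorus d L, (∑ σ : Fin 2,
      if (fermionTorusGraph d L).Adj x' y' then
        (Real.cosh ((fun i : Orb (FermionTorus d L) =>
            ε (ofLex i).2 * ψ (FermionTorus.toTorusSite (ofLex i).1)) (orb x' σ) -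
          (fun i : Orb (FermionTorus d L) =>
            ε (ofLex i).2 * ψ (FermionTorus.toTorusSite (ofLex i).1)) (orb y' σ)) - 1) else 0) =
        2 * (if (torusGraph d L).Adj (FermionTorus.toTorusSite x') (FermionTorus.toTorusSite y')
          then Real.cosh (ψ (FermionTorus.toTorusSite x') - ψ (FermionTorus.toTorusSite y')) - 1
          else 0) := by
    intro x' y'
    have e : ∀ (z : FermionTorus d L) (σ : Fin 2), (fun i : Orb (FermionTorus d L) =>
        ε (ofLex i).2 * ψ (FermionTorus.toTorusSite (ofLex i).1)) (orb z σ) =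
        ε σ * ψ (FermionTorus.toTorusSite z) := by
      intro z σ; simp [orb]
    simp only [e, hcosh]
    rw [Fin.sum_univ_two]
    by_cases h : (fermionTorusGraph d L).Adj x' y'
    · rw [if_pos h, if_pos ((fermionTorusGraph_adj x' y').mp h)]; ring
    · rw [if_neg h, if_neg (fun h' => h ((fermionTorusGraph_adj x' y').mpr h'))]; ring
  simp only [hσ, ← Finset.mul_sum]
  congr 1
  rw [← (FermionTorus.equivTorusSite (d := d) (L := L)).symm.sum_comp]
  refine sum_congr rfl fun u _ => ?_
  rw [← (FermionTorus.equivTorusSite (d := d) (L := L)).symm.sum_comp]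
  refine sum_congr rfl fun u' _ => ?_
  simp [FermionTorus.equivTorusSite]

/-- The magnetic observable as a fermionic monomial: `S⁺_x S⁻_y = (c†_{x↑} c_{x↓}) (c†_{y↓} c_{y↑})`.
Koma–Tasaki, PRL 68 (1992) 3248, eq. (3) and the last paragraph of the proof. [folklore] -/
theorem siteSpinPlus_mul_conjTranspose (x y : TorusSite d L) :
    siteSpinPlus x * (siteSpinPlus y)ᴴ =
      (creation (orb (FermionTorus.ofTorusSite x) 0) *
        annihilation (orb (FermionTorus.ofTorusSite x) 1)) *
      (creation (orb (FermionTorus.ofTorusSite y) 1) *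
        annihilation (orb (FermionTorus.ofTorusSite y) 0)) := by
  simp only [siteSpinPlus, conjTranspose_mul, creation_conjTranspose, annihilation_conjTranspose]

/-- The superconducting observable as a fermionic monomial:
`(c_{x↓} c_{x↑})† (c_{y↓} c_{y↑}) = (c†_{x↑} c†_{x↓}) (c_{y↓} c_{y↑})`.
Koma–Tasaki, PRL 68 (1992) 3248, eq. (2). [folklore] -/
theorem onSitePair_conjTranspose_mul (x y : TorusSite d L) :
    (onSitePair x)ᴴ * onSitePair y =
      (creation (orb (FermionTorus.ofTorusSite x) 0) *
        creation (orb (FermionTorus.ofTorusSite x) 1)) *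
      (annihilation (orb (FermionTorus.ofTorusSite y) 1) *
        annihilation (orb (FermionTorus.ofTorusSite y) 0)) := by
  rw [onSitePair_conjTranspose]; rfl

/-- **Koma–Tasaki bound for the transverse spin correlation with a free test function** (the
finite-volume eq. (12) of the magnetic case, before the choice of `φ`): for every real `ψ` on
`(ℤ/Lℤ)^d`, `β ≥ 0` and all `t, U, μ`,
`|⟨S⁺_x S⁻_y⟩_{β,L}| ≤ e^{-2(ψ x - ψ y)} exp [2 β |t| Σ_u Σ_{u'} [u ∼ u'] (cosh (ψ u - ψ u') - 1)]`
(spin-dependent weights `v_{(u,↑)} = -ψ u`, `v_{(u,↓)} = +ψ u`, eigenvalue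
`κ = e^{v_{x↑} - v_{x↓}} e^{v_{y↓} - v_{y↑}} = e^{-2(ψ x - ψ y)}`). Stated for an arbitrary
`[DecidableEq (FermionTorus d L)]` instance (see the module docstring).
Koma–Tasaki, PRL 68 (1992) 3248, eqs. (6)–(12) and the last paragraph of the proof.
[cite: KomaTasakiPRL1992, eq. (12), magnetic case] -/
theorem norm_thermalCorr_siteSpinPlus_le [instDE : DecidableEq (FermionTorus d L)]
    (t U μ β : ℝ) (hβ : 0 ≤ β) (ψ : TorusSite d L → ℝ) (x y : TorusSite d L) :
    ‖(hubbardTorusWith d L t U μ).thermalCorr β (siteSpinPlus x) (siteSpinPlus y)ᴴ‖ ≤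
      Real.exp (-(2 * (ψ x - ψ y))) * Real.exp (2 * (β * |t|) *
        ∑ u, ∑ u', (if (torusGraph d L).Adj u u' then Real.cosh (ψ u - ψ u') - 1 else 0)) := by
  obtain rfl : instDE = LinearOrder.toDecidableEq := Subsingleton.elim _ _
  letI instDE : DecidableEq (FermionTorus d L) := LinearOrder.toDecidableEq
  -- the spin-dependent gauge weights, sign pattern `ε = (-1, +1)`
  let ε : Fin 2 → ℝ := fun σ => if σ = 0 then -1 else 1
  have hε : ∀ σ, ε σ = 1 ∨ ε σ = -1 := fun σ => by
    simp only [ε]; split_ifs <;> simp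
  let v : Orb (FermionTorus d L) → ℝ := fun i =>
    ε (ofLex i).2 * ψ (FermionTorus.toTorusSite (ofLex i).1)
  have hv0 : ∀ z : FermionTorus d L, v (orb z 0) = -ψ (FermionTorus.toTorusSite z) := by
    intro z; simp [v, ε, orb]
  have hv1 : ∀ z : FermionTorus d L, v (orb z 1) = ψ (FermionTorus.toTorusSite z) := by
    intro z; simp [v, ε, orb]
  -- the observable and its gauge eigenvalue
  let X := FermionTorus.ofTorusSite x
  let Y := FermionTorus.ofTorusSite y
  let P : Matrix (Finset (Orb (FermionTorus d L))) (Finset (Orb (FermionTorus d L))) ℂ :=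
    creation (orb X 0) * annihilation (orb X 1)
  let Q : Matrix (Finset (Orb (FermionTorus d L))) (Finset (Orb (FermionTorus d L))) ℂ :=
    creation (orb Y 1) * annihilation (orb Y 0)
  have hAeq : siteSpinPlus x * (siteSpinPlus y)ᴴ = P * Q := siteSpinPlus_mul_conjTranspose x y
  have hWA := gauge_conj_mul v (gauge_conj_creation_mul_annihilation v (orb X 0) (orb X 1))
    (gauge_conj_creation_mul_annihilation v (orb Y 1) (orb Y 0))
  have hκn : ‖(Real.exp (v (orb X 0) - v (orb X 1)) : ℂ) *
      (Real.exp (v (orb Y 1) - v (orb Y 0)) : ℂ)‖ = Real.exp (-(2 * (ψ x - ψ y))) := by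
    rw [norm_mul, Complex.norm_real, Complex.norm_real, Real.norm_eq_abs, Real.norm_eq_abs,
      abs_of_pos (Real.exp_pos _), abs_of_pos (Real.exp_pos _), ← Real.exp_add, hv0, hv1, hv0, hv1]
    simp only [X, Y, FermionTorus.toTorusSite_ofTorusSite]
    ring_nf
  have hAn : ‖P * Q‖ ≤ 1 := by
    calc ‖P * Q‖ ≤ ‖P‖ * ‖Q‖ := l2_opNorm_mul _ _
      _ ≤ 1 * 1 := mul_le_mul (l2_opNorm_creation_mul_annihilation_le_one _ _)
          (l2_opNorm_creation_mul_annihilation_le_one _ _) (norm_nonneg _) zero_le_one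
      _ = 1 := one_mul 1
  have core := norm_gibbsState_hubbardTorusWith_le t U μ β hβ v (P * Q) _ hWA hAn
  rw [hκn, sum_cosh_signGauge ε hε ψ] at core
  rw [Matrix.thermalCorr, hAeq]
  refine core.trans (le_of_eq ?_)
  congr 1; ring_nf

/-- **Koma–Tasaki bound for the superconducting correlation with a free test function** (the
finite-volume eq. (12), before the choice of `φ`): for every real `ψ` on `(ℤ/Lℤ)^d`, `β ≥ 0`
and all `t, U, μ`,
`|⟨c†_{x↑} c†_{x↓} c_{y↓} c_{y↑}⟩_{β,L}| ≤ e^{-2(ψ x - ψ y)} exp [2 β |t| Σ_u Σ_{u'} [u ∼ u'] (cosh (ψ u - ψ u') - 1)]`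
(charge weights `v_{(u,σ)} = -ψ u`, eq. (5) with `θ = -iφ`, eigenvalue `e^{-2(φ_x - φ_y)}` as in
eq. (8)). Stated for an arbitrary `[DecidableEq (FermionTorus d L)]` instance.
Koma–Tasaki, PRL 68 (1992) 3248, eqs. (5)–(12). [cite: KomaTasakiPRL1992, eqs. (8) and (12)] -/
theorem norm_thermalCorr_onSitePair_le [instDE : DecidableEq (FermionTorus d L)]
    (t U μ β : ℝ) (hβ : 0 ≤ β) (ψ : TorusSite d L → ℝ) (x y : TorusSite d L) :
    ‖(hubbardTorusWith d L t U μ).thermalCorr β (onSitePair x)ᴴ (onSitePair y)‖ ≤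
      Real.exp (-(2 * (ψ x - ψ y))) * Real.exp (2 * (β * |t|) *
        ∑ u, ∑ u', (if (torusGraph d L).Adj u u' then Real.cosh (ψ u - ψ u') - 1 else 0)) := by
  obtain rfl : instDE = LinearOrder.toDecidableEq := Subsingleton.elim _ _
  letI instDE : DecidableEq (FermionTorus d L) := LinearOrder.toDecidableEq
  -- the charge gauge weights, sign pattern `ε ≡ -1`
  let ε : Fin 2 → ℝ := fun _ => -1
  have hε : ∀ σ, ε σ = 1 ∨ ε σ = -1 := fun σ => Or.inr rfl
  let v : Orb (FermionTorus d L) → ℝ := fun i =>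
    ε (ofLex i).2 * ψ (FermionTorus.toTorusSite (ofLex i).1)
  have hv : ∀ (z : FermionTorus d L) (σ : Fin 2), v (orb z σ) = -ψ (FermionTorus.toTorusSite z) := by
    intro z σ; simp [v, ε, orb]
  -- the observable and its gauge eigenvalue
  let X := FermionTorus.ofTorusSite x
  let Y := FermionTorus.ofTorusSite y
  let P : Matrix (Finset (Orb (FermionTorus d L))) (Finset (Orb (FermionTorus d L))) ℂ :=
    creation (orb X 0) * creation (orb X 1)
  let Q : Matrix (Finset (Orb (FermionTorus d L))) (Finset (Orb (FermionTorus d L))) ℂ :=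
    annihilation (orb Y 1) * annihilation (orb Y 0)
  have hAeq : (onSitePair x)ᴴ * onSitePair y = P * Q := onSitePair_conjTranspose_mul x y
  have hP := gauge_conj_mul v (gauge_conj_creation v (orb X 0)) (gauge_conj_creation v (orb X 1))
  have hQ := gauge_conj_mul v (gauge_conj_annihilation v (orb Y 1))
    (gauge_conj_annihilation v (orb Y 0))
  have hWA := gauge_conj_mul v hP hQ
  have hκn : ‖(Real.exp (v (orb X 0)) : ℂ) * (Real.exp (v (orb X 1)) : ℂ) *
      ((Real.exp (-v (orb Y 1)) : ℂ) * (Real.exp (-v (orb Y 0)) : ℂ))‖ =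
      Real.exp (-(2 * (ψ x - ψ y))) := by
    rw [norm_mul, norm_mul, norm_mul, Complex.norm_real, Complex.norm_real, Complex.norm_real,
      Complex.norm_real, Real.norm_eq_abs, Real.norm_eq_abs, Real.norm_eq_abs, Real.norm_eq_abs,
      abs_of_pos (Real.exp_pos _), abs_of_pos (Real.exp_pos _), abs_of_pos (Real.exp_pos _),
      abs_of_pos (Real.exp_pos _), ← Real.exp_add, ← Real.exp_add, ← Real.exp_add, hv, hv, hv, hv]
    simp only [X, Y, FermionTorus.toTorusSite_ofTorusSite]
    ring_nf
  have hAn : ‖P * Q‖ ≤ 1 := by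
    have h1 : ‖P‖ ≤ 1 := by
      calc ‖P‖ ≤ ‖creation (orb X 0)‖ * ‖creation (orb X 1)‖ := l2_opNorm_mul _ _
        _ ≤ 1 * 1 := mul_le_mul (norm_creation_le_one _) (norm_creation_le_one _)
            (norm_nonneg _) zero_le_one
        _ = 1 := one_mul 1
    have h2 : ‖Q‖ ≤ 1 := by
      calc ‖Q‖ ≤ ‖annihilation (orb Y 1)‖ * ‖annihilation (orb Y 0)‖ := l2_opNorm_mul _ _
        _ ≤ 1 * 1 := mul_le_mul (norm_annihilation_le_one _)
            (norm_annihilation_le_one _) (norm_nonneg _) zero_le_one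
        _ = 1 := one_mul 1
    calc ‖P * Q‖ ≤ ‖P‖ * ‖Q‖ := l2_opNorm_mul _ _
      _ ≤ 1 * 1 := mul_le_mul h1 h2 (norm_nonneg _) zero_le_one
      _ = 1 := one_mul 1
  have core := norm_gibbsState_hubbardTorusWith_le t U μ β hβ v (P * Q) _ hWA hAn
  rw [hκn, sum_cosh_signGauge ε hε ψ] at core
  rw [Matrix.thermalCorr, hAeq]
  refine core.trans (le_of_eq ?_)
  congr 1; ring_nf

end KomaTasakiProof

/-! ### The choice of the test function: uniform decay in `d = 2` and `d = 1` -/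

section Decay

open Real in
/-- Elementary choice of the charge: for `c ≥ 0` and `q = 1/(c + 1)` one has `0 < q ≤ 1` and
`c q² ≤ q` (Koma–Tasaki optimise `q` in eq. (13); any admissible `q` gives some `f(β) > 0`).
Koma–Tasaki, PRL 68 (1992) 3248, eq. (13). [folklore] -/
theorem charge_ineq {c : ℝ} (hc : 0 ≤ c) :
    0 < 1 / (c + 1) ∧ 1 / (c + 1) ≤ 1 ∧ c * (1 / (c + 1)) ^ 2 ≤ 1 / (c + 1) := by
  have h1 : 0 < c + 1 := by linarith
  refine ⟨by positivity, ?_, ?_⟩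
  · rw [div_le_one h1]; linarith
  · rw [div_pow, one_pow, ← div_eq_mul_one_div, div_le_div_iff₀ (by positivity) h1]
    nlinarith

variable {L : ℕ} [NeZero L]

/-- **Power-law decay in two dimensions from the test-function bound.** If a quantity `a` obeys
`a ≤ e^{-2(ψ x - ψ y)} exp [2 b Σ_u Σ_{u'} [u ∼ u'] (cosh (ψ u - ψ u') - 1)]` for every real `ψ`
on `(ℤ/Lℤ)²` (`b ≥ 0`), then `a ≤ e · (dist (x, y) + 1)^{-q}` with `q = 1/(128 b + 1)`: take the
McBryan–Spencer profile of `exists_testFunction_two` (`ψ x - ψ y = q log (R + 1)`, energy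
`≤ 64 q² (log (R + 1) + 1)`), so that the exponent is `≤ -2q log (R+1) + 128 b q² (log (R+1) + 1)
≤ -q log (R + 1) + q ≤ -q log (R + 1) + 1`. Koma–Tasaki, PRL 68 (1992) 3248, eqs. (12)–(13) and
P2. [cite: KomaTasakiPRL1992, eqs. (12)–(13)] -/
theorem le_rpow_of_forall_testFunction_two {b : ℝ} (hb : 0 ≤ b) (x y : TorusSite 2 L) {a : ℝ}
    (h : ∀ ψ : TorusSite 2 L → ℝ, a ≤ Real.exp (-(2 * (ψ x - ψ y))) * Real.exp (2 * b *
      ∑ u, ∑ u', (if (torusGraph 2 L).Adj u u' then Real.cosh (ψ u - ψ u') - 1 else 0))) :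
    a ≤ Real.exp 1 * ((torusDist x y : ℝ) + 1) ^ (-(1 / (128 * b + 1))) := by
  obtain ⟨hq0, hq1, hq⟩ := charge_ineq (c := 128 * b) (by positivity)
  set q : ℝ := 1 / (128 * b + 1) with hqdef
  obtain ⟨ψ, hψ, hE⟩ := exists_testFunction_two x y hq0.le hq1
  set R : ℕ := torusDist x y with hR
  set ℓ : ℝ := Real.log (R + 1) with hℓ
  have hℓ0 : 0 ≤ ℓ := Real.log_nonneg (by simp)
  set E : ℝ := ∑ u, ∑ u', (if (torusGraph 2 L).Adj u u' then Real.cosh (ψ u - ψ u') - 1 else 0)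
    with hEdef
  refine (h ψ).trans ?_
  rw [hψ, ← Real.exp_add, Real.rpow_def_of_pos (by positivity), ← Real.exp_add]
  refine Real.exp_le_exp.mpr ?_
  have hE' : 2 * b * E ≤ 2 * b * (64 * q ^ 2 * (ℓ + 1)) := mul_le_mul_of_nonneg_left hE (by positivity)
  have hbq : 128 * b * q ^ 2 * ℓ ≤ q * ℓ := mul_le_mul_of_nonneg_right hq hℓ0
  nlinarith

/-- **Exponential decay in one dimension from the test-function bound.** If `a` obeys
`a ≤ e^{-2(ψ x - ψ y)} exp [2 b Σ_u Σ_{u'} [u ∼ u'] (cosh (ψ u - ψ u') - 1)]` for every real `ψ`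
on `ℤ/Lℤ` (`b ≥ 0`), then `a ≤ e^{-m dist (x, y)}` with `m = 1/(16 b + 1)` (profile of
`exists_testFunction_one`: `ψ x - ψ y = m R`, energy `≤ 8 m² R`, so the exponent is
`≤ -2mR + 16 b m² R ≤ -mR`). Koma–Tasaki, PRL 68 (1992) 3248, eqs. (12)–(13) and P2 (`d = 1`).
[cite: KomaTasakiPRL1992, eqs. (12)–(13), d = 1] -/
theorem le_exp_of_forall_testFunction_one {b : ℝ} (hb : 0 ≤ b) (x y : TorusSite 1 L) {a : ℝ}
    (h : ∀ ψ : TorusSite 1 L → ℝ, a ≤ Real.exp (-(2 * (ψ x - ψ y))) * Real.exp (2 * b *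
      ∑ u, ∑ u', (if (torusGraph 1 L).Adj u u' then Real.cosh (ψ u - ψ u') - 1 else 0))) :
    a ≤ 1 * Real.exp (-(1 / (16 * b + 1)) * (torusDist x y : ℝ)) := by
  obtain ⟨hq0, hq1, hq⟩ := charge_ineq (c := 16 * b) (by positivity)
  set q : ℝ := 1 / (16 * b + 1) with hqdef
  obtain ⟨ψ, hψ, hE⟩ := exists_testFunction_one x y hq0.le hq1
  set R : ℕ := torusDist x y with hR
  have hR0 : (0 : ℝ) ≤ R := by positivity
  set E : ℝ := ∑ u, ∑ u', (if (torusGraph 1 L).Adj u u' then Real.cosh (ψ u - ψ u') - 1 else 0)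
    with hEdef
  refine (h ψ).trans ?_
  rw [hψ, ← Real.exp_add, one_mul]
  refine Real.exp_le_exp.mpr ?_
  have hE' : 2 * b * E ≤ 2 * b * (8 * q ^ 2 * R) := mul_le_mul_of_nonneg_left hE (by positivity)
  have hbq : 16 * b * q ^ 2 * R ≤ q * R := mul_le_mul_of_nonneg_right hq hR0
  nlinarith

end Decay

/-! ### The discharges -/

section Discharge

/-- **hubbard.S11** (Koma–Tasaki, magnetic correlations) — DISCHARGE of the named fact
`koma_tasaki_magnetic` of `HubbardHubbardModel`: power-law decay of `⟨S⁺_x S⁻_y⟩_{β,L}` on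
`(ℤ/Lℤ)²` (here with `f = 1/(128 β |t| + 1)`, `C = e`) and exponential decay on `ℤ/Lℤ`
(`m = 1/(16 β |t| + 1)`, `C = 1`), uniformly in `L`, for all `t, U, μ` and `β > 0`.
Koma–Tasaki, PRL 68 (1992) 3248, Theorem, eqs. (3), (4) and the one-dimensional case
("replace `|x - y|^{-α f(β)}` by `exp [-γ f(β) |x - y|]`").
[cite: KomaTasakiPRL1992, Theorem, eqs. (3) and (4)] -/
theorem koma_tasaki_magnetic_holds : koma_tasaki_magnetic := by
  intro t U μ β hβ
  have hb : 0 ≤ β * |t| := by positivity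
  refine ⟨⟨1 / (128 * (β * |t|) + 1), (charge_ineq (c := 128 * (β * |t|)) (by positivity)).1,
    Real.exp 1, fun L _ x y => ?_⟩, ⟨1 / (16 * (β * |t|) + 1),
    (charge_ineq (c := 16 * (β * |t|)) (by positivity)).1, 1, fun L _ x y => ?_⟩⟩
  · exact le_rpow_of_forall_testFunction_two hb x y
      (fun ψ => norm_thermalCorr_siteSpinPlus_le t U μ β hβ.le ψ x y)
  · exact le_exp_of_forall_testFunction_one hb x y
      (fun ψ => norm_thermalCorr_siteSpinPlus_le t U μ β hβ.le ψ x y)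

/-- **hubbard.S11** (Koma–Tasaki, `d = 1`, superconducting correlations) — DISCHARGE of the named
fact `koma_tasaki_1d` of `HubbardHubbardModel`: for all `t, U, μ` and `β > 0`,
`|⟨c†_{x↑} c†_{x↓} c_{y↓} c_{y↑}⟩_{β,L}| ≤ C e^{-m dist (x, y)}` on every ring `ℤ/Lℤ` (here
`m = 1/(16 β |t| + 1)`, `C = 1`). Koma–Tasaki, PRL 68 (1992) 3248, Theorem (one-dimensional
case). [cite: KomaTasakiPRL1992, Theorem (d = 1)] -/
theorem koma_tasaki_1d_holds : koma_tasaki_1d := by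
  intro t U μ β hβ
  have hb : 0 ≤ β * |t| := by positivity
  refine ⟨1 / (16 * (β * |t|) + 1), (charge_ineq (c := 16 * (β * |t|)) (by positivity)).1, 1,
    fun L _ x y => ?_⟩
  exact le_exp_of_forall_testFunction_one hb x y
    (fun ψ => norm_thermalCorr_onSitePair_le t U μ β hβ.le ψ x y)

end Discharge

end Literature.MathematicalPhysics.QuantumLattice
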